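import Summits.Ventures.PercRepro.Night2TwoWindowCoreA

/-!
# PercRepro — the type-`2` window of `(7, 5)` on the core: `0 ≤ J_2(G)` for `|G| ≤ 10` (night-2, gen 4; part B)

`SevenFiveLowLayersCoreFree` (night-4, `GenQSevenFiveColoopFree`) asks, on the coloop-free rank-`5` flats `G` of a
rank-`7` Core matroid, the type-`2` balance `0 ≤ Jq M G 5 2` for `|G| ≤ 10` and the type-`3` balance.  This file
proves the type-`2` clause — for EVERY rank-`5` set `G` with `|G| ≤ 10` of a simple matroid whose lines have
`≤ 3` points (the Core, `card_le_three_of_line_of_core`), coloops or not — through night-4's charging form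
`Jq_two_nonneg_of_charge`: every basis `B₀` of `G` receives from the spanning sets `B₀ ∪ P` (`P ⊆ G ∖ B₀`,
`|P| ∈ {1, 2}`) at least its deficit `1/3`.  With the per-set shares of part A (`Night2TwoWindowCoreA.lean`):

* `ext G B₀ j` = the `C(d, j)` extensions `B₀ ∪ P` (`d = |G ∖ B₀| ≤ 5`), rank-`5` subsets of `G` with `5 + j` points
  whose complement has `d − j` points (`card_ext`, `mem_ext`);
* `charge_ge_singles_add_pairs`: the charge of `B₀` is at least the sum over the singles and the pairs, every
  other term being `≥ 0`;
* **`Jq_two_nonneg_five_of_card_le_ten`** (`Simple M`, lines `≤ 3` points, `ρ(G) = 5`, `|G| ≤ 10`) and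
  **`Jq_two_nonneg_five_of_core`** (`Core M p`, `G ∈ flatsQ M 5`, `|G| ≤ 10`): the case split on `d`:
  `d ≤ 1` (`B₀` not demanding), `d = 2` (two non-demanding singles, `2 · 5/12`), `d = 3` (`3/36 + 3 · 1/6`),
  `d = 4` (`4/36 + 6/20`), `d = 5` (`5/36 + 10/20`) — each `≥ 1/3`.

Imports `Night2TwoWindowCoreA` only.
-/
namespace PercRepro.Star

open Finset ThmH SixFour GenQ PerFlat NightThree

variable {α : Type*} [DecidableEq α] {M : Matroid α} [M.Finite]

/-! ## The supersets `B₀ ∪ P`, `P ⊆ G ∖ B₀`, `|P| = j` -/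

/-- The `j`-point extensions of `B₀` inside `G`: the sets `B₀ ∪ P` with `P ⊆ G ∖ B₀`, `|P| = j`. -/
def ext (G B₀ : Finset α) (j : ℕ) : Finset (Finset α) :=
  ((G \ B₀).powersetCard j).image (fun P => B₀ ∪ P)

/-- There are `C(|G ∖ B₀|, j)` extensions. -/
theorem card_ext (G B₀ : Finset α) (j : ℕ) : (ext G B₀ j).card = (G \ B₀).card.choose j := by
  unfold ext
  rw [Finset.card_image_of_injOn, Finset.card_powersetCard]
  intro P hP P' hP' h
  have hP1 : P ⊆ G \ B₀ := (Finset.mem_powersetCard.1 (Finset.mem_coe.1 hP)).1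
  have hP1' : P' ⊆ G \ B₀ := (Finset.mem_powersetCard.1 (Finset.mem_coe.1 hP')).1
  have hd : Disjoint P B₀ := Finset.disjoint_of_subset_left hP1 Finset.sdiff_disjoint
  have hd' : Disjoint P' B₀ := Finset.disjoint_of_subset_left hP1' Finset.sdiff_disjoint
  have e1 : P = (B₀ ∪ P) \ B₀ := by rw [Finset.union_sdiff_left, Finset.sdiff_eq_self_of_disjoint hd]
  have e2 : P' = (B₀ ∪ P') \ B₀ := by rw [Finset.union_sdiff_left, Finset.sdiff_eq_self_of_disjoint hd']
  simp only at h
  rw [e1, e2, h]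

/-- An extension is a rank-`5` subset of `G` with `5 + j` points containing `B₀`, and its complement in `G` has
`|G ∖ B₀| − j` points. -/
theorem mem_ext {G B₀ B : Finset α} {j : ℕ} (hr : M.eRk (G : Set α) = 5) (hB₀ : B₀ ∈ basesOf M G 5)
    (hB : B ∈ ext G B₀ j) :
    B ∈ Rq M G 5 ∧ B.card = 5 + j ∧ B₀ ⊆ B ∧ (G \ B).card = (G \ B₀).card - j := by
  unfold ext at hB
  obtain ⟨P, hP, rfl⟩ := Finset.mem_image.1 hB
  have hP' := Finset.mem_powersetCard.1 hP
  have hB₀' := mem_basesOf.1 hB₀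
  have hd : Disjoint B₀ P := (Finset.disjoint_of_subset_left hP'.1 Finset.sdiff_disjoint).symm
  have hsubG : B₀ ∪ P ⊆ G := Finset.union_subset hB₀'.1 (hP'.1.trans Finset.sdiff_subset)
  refine ⟨?_, ?_, Finset.subset_union_left, ?_⟩
  · rw [mem_Rq]
    refine ⟨hsubG, le_antisymm ?_ ?_⟩
    · have := M.eRk_mono (Finset.coe_subset.2 hsubG)
      rw [hr] at this
      exact this
    · have := M.eRk_mono (Finset.coe_subset.2 (Finset.subset_union_left (s₁ := B₀) (s₂ := P)))
      rw [hB₀'.2.1] at this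
      exact this
  · rw [Finset.card_union_of_disjoint hd, hB₀'.2.2, hP'.2]
  · have e : G \ (B₀ ∪ P) = (G \ B₀) \ P := by
      ext x
      simp only [Finset.mem_sdiff, Finset.mem_union]
      tauto
    rw [e, Finset.card_sdiff_of_subset hP'.1, hP'.2]

/-- The extensions with `j ≥ 1` are spanning non-bases above `B₀`. -/
theorem ext_subset_filter {G B₀ : Finset α} {j : ℕ} (hr : M.eRk (G : Set α) = 5) (hB₀ : B₀ ∈ basesOf M G 5)
    (hj : 1 ≤ j) : ext G B₀ j ⊆ (Rq M G 5).filter (fun B => B.card ≠ 5 ∧ B₀ ⊆ B) := by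
  intro B hB
  obtain ⟨h1, h2, h3, _⟩ := mem_ext hr hB₀ hB
  exact Finset.mem_filter.2 ⟨h1, by omega, h3⟩

/-- The singles and the pairs are disjoint families. -/
theorem disjoint_ext_one_two {G B₀ : Finset α} (hr : M.eRk (G : Set α) = 5) (hB₀ : B₀ ∈ basesOf M G 5) :
    Disjoint (ext G B₀ 1) (ext G B₀ 2) := by
  rw [Finset.disjoint_left]
  intro B h1 h2
  have := (mem_ext hr hB₀ h1).2.1
  have := (mem_ext hr hB₀ h2).2.1
  omega

/-- **The charge of a basis is at least the sum over its singles and pairs** (every other share is `≥ 0`). -/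
theorem charge_ge_singles_add_pairs (hs : Simple M) {G B₀ : Finset α} (hG : G ⊆ gr M)
    (hr : M.eRk (G : Set α) = 5) (hB₀ : B₀ ∈ basesOf M G 5) :
    ∑ B ∈ ext G B₀ 1, wTwo M G B 5 / (nb M G B 5 : ℚ) + ∑ B ∈ ext G B₀ 2, wTwo M G B 5 / (nb M G B 5 : ℚ) ≤
      charge M G 5 B₀ := by
  unfold charge
  rw [← Finset.sum_union (disjoint_ext_one_two hr hB₀)]
  apply Finset.sum_le_sum_of_subset_of_nonneg
  · exact Finset.union_subset (ext_subset_filter hr hB₀ le_rfl) (ext_subset_filter hr hB₀ (by norm_num))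
  · intro B hB _
    have hB' := Finset.mem_filter.1 hB
    exact share_nonneg hs hG (by norm_num) hB'.1 hB'.2.1

/-- A lower bound `b` on every share of the `j`-extensions gives `C(d, j)·b` on their sum. -/
theorem sum_ext_ge {G B₀ : Finset α} {j : ℕ} (b : ℚ)
    (h : ∀ B ∈ ext G B₀ j, b ≤ wTwo M G B 5 / (nb M G B 5 : ℚ)) :
    ((G \ B₀).card.choose j : ℚ) * b ≤ ∑ B ∈ ext G B₀ j, wTwo M G B 5 / (nb M G B 5 : ℚ) := by
  have := Finset.card_nsmul_le_sum (ext G B₀ j) (fun B => wTwo M G B 5 / (nb M G B 5 : ℚ)) b h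
  rw [card_ext, nsmul_eq_mul] at this
  exact this

/-- The charge is nonnegative. -/
theorem charge_nonneg (hs : Simple M) {G B₀ : Finset α} (hG : G ⊆ gr M) : 0 ≤ charge M G 5 B₀ := by
  unfold charge
  apply Finset.sum_nonneg
  intro B hB
  have hB' := Finset.mem_filter.1 hB
  exact share_nonneg hs hG (by norm_num) hB'.1 hB'.2.1

/-! ## The type-`2` window -/

/-- **The type-`2` balance at `q = 5` on every rank-`5` set with at most `10` points** of a simple matroid whose
lines have at most `3` points. -/
theorem Jq_two_nonneg_five_of_card_le_ten (hs : Simple M) (hline : ∀ L ∈ flatsQ M 2, L.card ≤ 3)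
    {G : Finset α} (hG : G ⊆ gr M) (hr : M.eRk (G : Set α) = 5) (hcard : G.card ≤ 10) : 0 ≤ Jq M G 5 2 := by
  apply Jq_two_nonneg_of_charge
  intro B₀ hB₀
  have hB₀' := mem_basesOf.1 hB₀
  have hd : (G \ B₀).card = G.card - 5 := by rw [Finset.card_sdiff_of_subset hB₀'.1, hB₀'.2.2]
  have hw := wTwo_of_mem_basesOf hB₀
  have hdem1 := dem_le_one (M := M) G 2 B₀
  have hch := charge_ge_singles_add_pairs hs hG hr hB₀
  have hc0 := charge_nonneg hs (B₀ := B₀) hG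
  -- the shares of the singles and the pairs
  have h1 : ∀ B ∈ ext G B₀ 1, 1 / 36 ≤ wTwo M G B 5 / (nb M G B 5 : ℚ) := by
    intro B hB
    obtain ⟨hB1, hB2, _, _⟩ := mem_ext hr hB₀ hB
    exact share_six_ge hs hG hB1 hB2
  have h2 : ∀ B ∈ ext G B₀ 2, 1 / 20 ≤ wTwo M G B 5 / (nb M G B 5 : ℚ) := by
    intro B hB
    obtain ⟨hB1, hB2, _, _⟩ := mem_ext hr hB₀ hB
    exact share_seven_ge hs hline hG hB1 hB2
  have hs1 := sum_ext_ge (M := M) (G := G) (B₀ := B₀) (1 / 36) h1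
  have hs2 := sum_ext_ge (M := M) (G := G) (B₀ := B₀) (1 / 20) h2
  have hs1' : (0 : ℚ) ≤ ∑ B ∈ ext G B₀ 1, wTwo M G B 5 / (nb M G B 5 : ℚ) := by
    refine le_trans ?_ hs1
    positivity
  have hs2' : (0 : ℚ) ≤ ∑ B ∈ ext G B₀ 2, wTwo M G B 5 / (nb M G B 5 : ℚ) := by
    refine le_trans ?_ hs2
    positivity
  rcases (show (G \ B₀).card ≤ 1 ∨ (G \ B₀).card = 2 ∨ (G \ B₀).card = 3 ∨ (G \ B₀).card = 4 ∨
      (G \ B₀).card = 5 by omega) with h | h | h | h | h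
  · -- `d ≤ 1`: `B₀` is not demanding
    rw [dem_two_eq_zero_of_card_le_one h] at hw
    rw [hw]
    push_cast
    linarith
  · -- `d = 2`: the two singles are not demanding, each share `≥ 5/12`
    have h1' : ∀ B ∈ ext G B₀ 1, 5 / 12 ≤ wTwo M G B 5 / (nb M G B 5 : ℚ) := by
      intro B hB
      obtain ⟨hB1, hB2, _, hB4⟩ := mem_ext hr hB₀ hB
      exact share_six_ge_of_compl_le_one hs hG hB1 hB2 (by omega)
    have hs1'' := sum_ext_ge (M := M) (G := G) (B₀ := B₀) (5 / 12) h1'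
    rw [h] at hs1''
    norm_num at hs1''
    rw [hw]
    push_cast
    nlinarith
  · -- `d = 3`: the three pairs are not demanding, each share `≥ 1/6`
    have h2' : ∀ B ∈ ext G B₀ 2, 1 / 6 ≤ wTwo M G B 5 / (nb M G B 5 : ℚ) := by
      intro B hB
      obtain ⟨hB1, hB2, _, hB4⟩ := mem_ext hr hB₀ hB
      exact share_seven_ge_of_compl_le_one hs hline hG hB1 hB2 (by omega)
    have hs2'' := sum_ext_ge (M := M) (G := G) (B₀ := B₀) (1 / 6) h2'
    rw [h] at hs1 hs2''
    norm_num [Nat.choose] at hs1 hs2''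
    rw [hw]
    push_cast
    nlinarith
  · -- `d = 4`: `4/36 + 6/20 ≥ 1/3`
    rw [h] at hs1 hs2
    norm_num [Nat.choose] at hs1 hs2
    rw [hw]
    push_cast
    nlinarith
  · -- `d = 5`: `5/36 + 10/20 ≥ 1/3`
    rw [h] at hs1 hs2
    norm_num [Nat.choose] at hs1 hs2
    rw [hw]
    push_cast
    nlinarith

/-- **The type-`2` clause of `SevenFiveLowLayersCoreFree`**: on a Core matroid, every rank-`5` flat with at most
`10` points has `0 ≤ Jq M G 5 2`. -/
theorem Jq_two_nonneg_five_of_core {γ : Type} [DecidableEq γ] {M : Matroid γ} [M.Finite] {p : ℕ} (hc : Core M p)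
    {G : Finset γ} (hG : G ∈ flatsQ M 5) (hcard : G.card ≤ 10) : 0 ≤ Jq M G 5 2 := by
  have hG' := mem_flatsQ.1 hG
  have hr : M.eRk (G : Set γ) = 5 := by
    have := hG'.2.2
    exact_mod_cast this
  exact Jq_two_nonneg_five_of_card_le_ten (simple_of_core hc) (fun L hL => card_le_three_of_line_of_core hc hL)
    hG'.1 hr hcard


end PercRepro.Star
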